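import Summits.ABC.IUTFork.Thm311LinkLattice
import Summits.ABC.IUTFork.Thm311Remarks
import Mathlib.CategoryTheory.EssentiallySmall
import Mathlib.CategoryTheory.Category.ULift
import HarnessLib

/-!
# [IUTchIII] Theorem 3.11 in the author's terms, J2: the objects of (iii) over a frame of ANY universe — the small model (R-c)

Record-only file (D-0012) of the abc-iut cell (seat abc-iut-c312-1); TAKES NO SIDE. Sequel to `Thm311LinkLattice`
(J). PURPOSE (bookkeeping; no mathematics of [IUTchIII] is at stake): D's signature `Thm311.LinkData` puts the
category of `F⊢×μ`-prime-strips in universe `0` (`Strip : Type`, `Category.{0}`), so J's constructors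
`LinkData.ofFunctors` / `ofBiCoric` / `ofGlue` take a frame `S : StripFrame.{0}`, while the REAL frame assembled from
the [IUTchI]/[IUTchII] kits, abc-iut-L6-t3's `StripFrame.ofKits : StripFrame.{max 1 u}` (its Hodge-theater records
carry a field `T : Type`), lives one universe up (finding F-w5d029-1; patch plan "R-a" = make `LinkData`
universe-polymorphic and re-pin every consumer — 7 files when planned, several dozen by now). This file is the
ADDITIVE alternative ("R-c", the owner's choice): nothing in the tree is edited.

The observation: `LinkData` never uses the whole category of strips — only the countable family of objects
`^{n,m}F⊢×μ_△`, `F⊢×μ_△(^{n,∘}D⊢_△)`, `F⊢×μ_env(^{n,∘}D_>)` (`n, m ∈ ℤ`), the isomorphisms among them, and the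
automorphism groups of the `^{n,m}HT`; likewise for the radial and `∞κ` data. For a family `obj : I → C` in a
LOCALLY SMALL category (`Mathlib` `LocallySmall.{0} C`: every hom-set is in bijection with a `Type`; true for the
kit categories — morphisms are maps between `Type`-valued carriers — and preserved by `AsSmall`,
`locallySmall_asSmall`) indexed by `I : Type`, the **small model** `SmallFamily obj` (objects `I`, morphisms
`Shrink (obj i ⟶ obj j)`; = `Mathlib`'s `ShrinkHoms (InducedCategory C obj)`, spelled out so that the transport of
isomorphisms `isoToSmall`/`isoEquiv` is definitional) is a universe-`0` category EQUIVALENT to the full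
subcategory of `C` on the family (the transport is a bijection on hom-sets compatible with composition,
`isoToSmall_trans`). Every clause D types about `LinkData` — full poly-isomorphisms, "stabilized", "equivariant",
(IPL), the (SHE)-loop — concerns composites of isomorphisms among these objects, hence is INVARIANT under the
transport (`toSmall_full`, `stabilized_toSmall_iff`).

Contents: §1 `SmallFamily`; §2 `LinkData.ofFunctorsSmall` — J's `ofFunctors` verbatim ([IUTchIII] Thm. 3.11 (iii)
objects from the lattice `H`, line representatives `Dl`, `ξ`, the Frobenius-like/étale-like `F⊢×μ_△` functors with
the Kummer NATURAL isomorphism (Thm. 1.5 (iii)), `F⊢×μ_env` with Prop. 2.1 (vi)'s natural isomorphism, radial data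
(Cor. 2.3) and `∞κ` data ([IUTchII] Cor. 4.7 (iii)) as functors) over categories of ARBITRARY universes, landing in
`LinkData`; (iii)(c)/(d) AS TYPED hold for it (`ofFunctorsSmall_partIIIc/partIIId`: Kummer naturality +
functoriality, as in J); (IPL) from connectedness; §3 `LinkData.ofBiCoricSmall` over abc-iut-L6-t3's
`BiCoricData S`, `S : StripFrame.{u}`, any `u`; §4 `FullSituation.ofBiCoricSmall` with `statement_iff` (⟺ (i) ∧
(ii), J's `statement_iff_partI_partII_of_link`). The instantiation at `StripFrame.ofKits` is the sequel J3
(`Thm311LinkSmallKits`), kept apart so that this file does not import the kit tower.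

Sources: [IUTchIII] Thm. 3.11 (iii) pp. 156–158, Thm. 1.5 (iii) pp. 49–50, Prop. 2.1 (vi) p. 61, Cor. 2.3 (ii)
p. 73 (as in J; nothing new is read). [claim: Mochizuki2012, status: disputed]
Deliberately NOT here: any edit of D/J/L (R-a); any judgement.
-/

noncomputable section
noncomputable section

namespace Summit.ABC

namespace IUTFork

namespace Thm311

open CategoryTheory
open Literature.IUT.HodgeTheaters (PolyIso)
open Literature.IUT.LogThetaLattice

universe w v u v₁ u₁ v₂ u₂ v₃ u₃ v₄ u₄ v₅ u₅

/-! ## 1. The small model of a family of objects of a locally small category -/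

/-- `AsSmall.{w} C` (used by abc-iut-L6-t3's `StripFrame.ofKits` to place the kit categories in one universe) is
locally `v`-small when `C` has `v`-small hom-sets: its hom-types are `ULift`s of those of `C`. [folklore] -/
instance locallySmall_asSmall (C : Type u) [Category.{v} C] : LocallySmall.{v} (AsSmall.{w} C) :=
  ⟨fun X Y => ⟨⟨ULift.down X ⟶ ULift.down Y, ⟨Equiv.ulift⟩⟩⟩⟩

/-- **The small model of a family of objects.** For `obj : I → C` with `I : Type` and `C` locally small
(`LocallySmall.{0} C`): the category with objects `I` and morphisms `Shrink (obj i ⟶ obj j)` — `Mathlib`'s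
`ShrinkHoms (InducedCategory C obj)`, spelled out. [folklore] -/
def SmallFamily {I : Type} {C : Type u} [Category.{v} C] (_obj : I → C) : Type := I

namespace SmallFamily

variable {I : Type} {C : Type u} [Category.{v} C] {obj : I → C} [LocallySmall.{0} C]

/-- The object of the small model indexed by `i`. [folklore] -/
abbrev mk (obj : I → C) (i : I) : SmallFamily obj := i

/-- The small model is a category (universe `0`): composition is that of `C`, transported. [folklore] -/
instance : Category.{0} (SmallFamily obj) where
  Hom i j := Shrink.{0} (obj i ⟶ obj j)
  id i := equivShrink _ (𝟙 (obj i))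
  comp f g := equivShrink _ ((equivShrink _).symm f ≫ (equivShrink _).symm g)
  id_comp f := by simp
  comp_id f := by simp
  assoc f g h := by simp

/-- Composition in the small model is that of `C` (read through `equivShrink`). [folklore] -/
@[simp] theorem symm_comp {i j k : SmallFamily obj} (f : i ⟶ j) (g : j ⟶ k) :
    (equivShrink (obj i ⟶ obj k)).symm (f ≫ g) =
      (equivShrink (obj i ⟶ obj j)).symm f ≫ (equivShrink (obj j ⟶ obj k)).symm g :=
  Equiv.symm_apply_apply _ _

/-- Identities of the small model are those of `C`. [folklore] -/
@[simp] theorem symm_id (i : SmallFamily obj) : (equivShrink (obj i ⟶ obj i)).symm (𝟙 i) = 𝟙 (obj i) :=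
  Equiv.symm_apply_apply _ _

/-- Transport of an isomorphism `obj i ≅ obj j` of `C` to the small model. [folklore] -/
@[simps] def isoToSmall {i j : I} (e : obj i ≅ obj j) : mk obj i ≅ mk obj j where
  hom := equivShrink (obj i ⟶ obj j) e.hom
  inv := equivShrink (obj j ⟶ obj i) e.inv
  hom_inv_id := (equivShrink (obj i ⟶ obj i)).symm.injective (by simp)
  inv_hom_id := (equivShrink (obj j ⟶ obj j)).symm.injective (by simp)

/-- Transport of an isomorphism of the small model back to `C`. [folklore] -/
@[simps] def isoOfSmall {i j : I} (f : mk obj i ≅ mk obj j) : obj i ≅ obj j where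
  hom := (equivShrink (obj i ⟶ obj j)).symm f.hom
  inv := (equivShrink (obj j ⟶ obj i)).symm f.inv
  hom_inv_id := by rw [← symm_comp, f.hom_inv_id, symm_id]
  inv_hom_id := by rw [← symm_comp, f.inv_hom_id, symm_id]

/-- **Transport of isomorphisms** `obj i ≅ obj j` (in `C`) to the small model is a BIJECTION. [folklore] -/
@[simps] def isoEquiv (i j : I) : (obj i ≅ obj j) ≃ (mk obj i ≅ mk obj j) where
  toFun := isoToSmall
  invFun := isoOfSmall
  left_inv e := Iso.ext (by simp)
  right_inv f := Iso.ext (by simp)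

/-- The transport is compatible with composition … [folklore] -/
@[simp] theorem isoToSmall_trans {i j k : I} (e : obj i ≅ obj j) (e' : obj j ≅ obj k) :
    isoToSmall (e ≪≫ e') = isoToSmall e ≪≫ isoToSmall e' :=
  Iso.ext ((equivShrink (obj i ⟶ obj k)).symm.injective (by simp))

/-- … and with identities. [folklore] -/
@[simp] theorem isoToSmall_refl (i : I) : isoToSmall (Iso.refl (obj i)) = Iso.refl (mk obj i) :=
  Iso.ext ((equivShrink (obj i ⟶ obj i)).symm.injective (by simp))

/-- A commuting square of isomorphisms of `C` transports to a commuting square of the small model. [folklore] -/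
theorem isoToSmall_sq {i j : I} {a : obj i ≅ obj i} {k : obj i ≅ obj j} {b : obj j ≅ obj j}
    (h : a ≪≫ k = k ≪≫ b) : isoToSmall a ≪≫ isoToSmall k = isoToSmall k ≪≫ isoToSmall b := by
  rw [← isoToSmall_trans, ← isoToSmall_trans, h]

/-- Transport of a poly-isomorphism ([IUTchI] §0: a set of isomorphisms) to the small model. [folklore] -/
def toSmall {i j : I} (P : PolyIso (obj i) (obj j)) : PolyIso (mk obj i) (mk obj j) := isoToSmall '' P

/-- Membership in a transported poly-isomorphism. [folklore] -/
theorem mem_toSmall {i j : I} {P : PolyIso (obj i) (obj j)} {f : mk obj i ≅ mk obj j} :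
    f ∈ toSmall P ↔ isoOfSmall f ∈ P := by
  constructor
  · rintro ⟨e, he, rfl⟩
    have : isoOfSmall (isoToSmall e) = e := (isoEquiv i j).left_inv e
    rwa [this]
  · intro h
    exact ⟨_, h, (isoEquiv i j).right_inv f⟩

/-- Transports of isomorphisms of `C` are members of the transport of `P` iff the originals are in `P`. [folklore] -/
@[simp] theorem isoToSmall_mem_toSmall {i j : I} {P : PolyIso (obj i) (obj j)} {e : obj i ≅ obj j} :
    isoToSmall e ∈ toSmall P ↔ e ∈ P := by
  rw [mem_toSmall]
  exact iff_of_eq (congrArg (· ∈ P) ((isoEquiv i j).left_inv e))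

/-- **The FULL poly-isomorphism transports to the FULL poly-isomorphism** (the transport is onto). [folklore] -/
theorem toSmall_full (i j : I) : toSmall (PolyIso.full (obj i) (obj j)) = PolyIso.full (mk obj i) (mk obj j) :=
  Set.image_univ_of_surjective (isoEquiv i j).surjective

/-- "Stabilized" ([IUTchIII] Thm. 3.11 (iii) (c)(d), D's `PolyIsoCalc.Stabilized`) is INVARIANT under the
transport to the small model. [folklore] -/
theorem stabilized_toSmall_iff {i j : I} (P : PolyIso (obj i) (obj j)) (GX : Set (obj i ≅ obj i))
    (GY : Set (obj j ≅ obj j)) :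
    PolyIsoCalc.Stabilized (toSmall P) (toSmall GX) (toSmall GY) ↔ PolyIsoCalc.Stabilized P GX GY := by
  constructor
  · intro h a ha b hb f hf
    have := h _ ⟨a, ha, rfl⟩ _ ⟨b, hb, rfl⟩ _ ⟨f, hf, rfl⟩
    rwa [← isoToSmall_trans, ← isoToSmall_trans, isoToSmall_mem_toSmall] at this
  · rintro h _ ⟨a, ha, rfl⟩ _ ⟨b, hb, rfl⟩ _ ⟨f, hf, rfl⟩
    rw [← isoToSmall_trans, ← isoToSmall_trans, isoToSmall_mem_toSmall]
    exact h a ha b hb f hf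

end SmallFamily

/-! ## 2. The objects of (iii) constructed over categories of any universe, landing in `LinkData` -/

namespace LinkData

section

variable {HTC : Type u₁} [Category.{v₁} HTC] {DC : Type u₂} [Category.{v₂} DC] {FC : Type u₃} [Category.{v₃} FC]
  (htToD : HTC ⥤ DC) (H : ℤ × ℤ → HTC) (Dl : ℤ → DC) (ξ : ∀ n m : ℤ, htToD.obj (H (n, m)) ≅ Dl n)
  (Ffr : HTC ⥤ FC) (Fet : DC ⥤ FC) (kum : Ffr ≅ htToD ⋙ Fet) (Fenv : DC ⥤ FC) (nat : Fet ≅ Fenv)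
  {RadC : Type u₄} [Category.{v₄} RadC] (FR : DC ⥤ RadC) {KapC : Type u₅} [Category.{v₅} KapC]
  (FM : DC ⥤ KapC)

/-- The family of `F⊢×μ`-prime-strips `LinkData` actually uses: `^{n,m}F⊢×μ_△` (index `inl (n,m)`),
`F⊢×μ_△(^{n,∘}D⊢_△)` (`inr (inl n)`), `F⊢×μ_env(^{n,∘}D_>)` (`inr (inr n)`). [folklore] -/
def stripObj : (ℤ × ℤ) ⊕ (ℤ ⊕ ℤ) → FC :=
  Sum.elim (fun nm => Ffr.obj (H nm)) (Sum.elim (fun n => Fet.obj (Dl n)) fun n => Fenv.obj (Dl n))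

/-- The automorphism of `^{n,∘}HT^D` induced by an automorphism of `^{n,m}HT` (J's `autD`, any universe).
[folklore] -/
def autDU (n m : ℤ) (a : H (n, m) ≅ H (n, m)) : Dl n ≅ Dl n := (ξ n m).symm ≪≫ htToD.mapIso a ≪≫ ξ n m

/-- The Kummer isomorphism `†F^{⊢×μ}_△ ⥲ F^{⊢×μ}_△(†D^⊢_△)` at ONE Hodge theater `X` — the component of `kum` with
syntactically plain type (J's `kumAt`, any universe). [claim: Mochizuki2012, status: disputed] -/
def kumAtU (X : HTC) : Ffr.obj X ≅ Fet.obj (htToD.obj X) := kum.app X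

/-- Kummer NATURALITY in `C` (J's `kumAt_naturality`, any universe): for `a : X ≅ X'`, `Ffr(a)` then the Kummer
isomorphism at `X'` equals the Kummer isomorphism at `X` then `Fet(D(a))`. [folklore] -/
theorem kumAtU_naturality {X X' : HTC} (a : X ≅ X') :
    Ffr.mapIso a ≪≫ kumAtU htToD Ffr Fet kum X' = kumAtU htToD Ffr Fet kum X ≪≫ Fet.mapIso (htToD.mapIso a) := by
  ext
  exact kum.hom.naturality a.hom

/-- **(iii) (c), equivariance clause, in `C`**: the Kummer isomorphism `kum_X ≪≫ Fet(ξ)` at `^{n,m}HT` intertwines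
`Ffr(a)` with `Fet` of the induced automorphism of `^{n,∘}HT^D` (J's `ofFunctors_kumDelta_equivariant`, any
universe). [folklore] -/
theorem kum_equivariant (n m : ℤ) (a : H (n, m) ≅ H (n, m)) :
    Ffr.mapIso a ≪≫ (kumAtU htToD Ffr Fet kum (H (n, m)) ≪≫ Fet.mapIso (ξ n m)) =
      (kumAtU htToD Ffr Fet kum (H (n, m)) ≪≫ Fet.mapIso (ξ n m)) ≪≫ Fet.mapIso (autDU htToD H Dl ξ n m a) := by
  rw [autDU, ← Iso.trans_assoc, kumAtU_naturality htToD Ffr Fet kum, Iso.trans_assoc, Iso.trans_assoc,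
    ← Functor.mapIso_trans, ← Functor.mapIso_trans, Iso.self_symm_id_assoc]

variable [LocallySmall.{0} HTC] [LocallySmall.{0} FC] [LocallySmall.{0} RadC] [LocallySmall.{0} KapC]

/-- **The objects of [IUTchIII] Thm. 3.11 (iii), CONSTRUCTED over categories of any universe** — J's
`LinkData.ofFunctors` (lattice `H : (n,m) ↦ ^{n,m}HT`, line representatives `Dl n = ^{n,∘}HT^D` with `ξ n m :
D(^{n,m}HT) ≅ ^{n,∘}HT^D`, Frobenius-like `Ffr : †HT ↦ †F⊢×μ_△` and étale-like `Fet : †HT^D ↦ F⊢×μ_△(†D⊢_△)` with the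
Kummer NATURAL isomorphism `kum` (Thm. 1.5 (iii)), `Fenv` with Prop. 2.1 (vi)'s `nat`, radial data `FR` (Cor. 2.3)
and `∞κ` data `FM` ([IUTchII] Cor. 4.7 (iii)); permutation-symmetry poly-isomorphisms = functorial images of the
FULL poly-isomorphism `^{n,∘}HT^D ⥲ ^{n+1,∘}HT^D`; `Aut(^{n,m}HT)` acting through the functors) — with every object
replaced by its index in the SMALL MODEL of the family it belongs to and every (poly-)isomorphism transported along
`SmallFamily.isoToSmall`. [claim: Mochizuki2012, status: disputed] -/
def ofFunctorsSmall : LinkData where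
  Strip := SmallFamily (stripObj H Dl Ffr Fet Fenv)
  Fdelta n m := SmallFamily.mk _ (Sum.inl (n, m))
  FdeltaD n := SmallFamily.mk _ (Sum.inr (Sum.inl n))
  kumDelta n m := SmallFamily.isoToSmall (obj := stripObj H Dl Ffr Fet Fenv) (i := Sum.inl (n, m))
    (j := Sum.inr (Sum.inl n)) (kumAtU htToD Ffr Fet kum (H (n, m)) ≪≫ Fet.mapIso (ξ n m))
  FenvD n := SmallFamily.mk _ (Sum.inr (Sum.inr n))
  natEnvD n := SmallFamily.isoToSmall (obj := stripObj H Dl Ffr Fet Fenv) (i := Sum.inr (Sum.inl n))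
    (j := Sum.inr (Sum.inr n)) (nat.app (Dl n))
  Rad := SmallFamily (fun n : ℤ => FR.obj (Dl n))
  R n := SmallFamily.mk _ n
  permR n := SmallFamily.toSmall (obj := fun n : ℤ => FR.obj (Dl n)) (i := n) (j := n + 1)
    ((PolyIso.full (Dl n) (Dl (n + 1))).map FR)
  Kap := SmallFamily (fun n : ℤ => FM.obj (Dl n))
  Mk n := SmallFamily.mk _ n
  permM n := SmallFamily.toSmall (obj := fun n : ℤ => FM.obj (Dl n)) (i := n) (j := n + 1)
    ((PolyIso.full (Dl n) (Dl (n + 1))).map FM)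
  AutHT n m := SmallFamily.mk H (n, m) ≅ SmallFamily.mk H (n, m)
  onDelta n m a := SmallFamily.isoToSmall (obj := stripObj H Dl Ffr Fet Fenv) (i := Sum.inl (n, m))
    (j := Sum.inl (n, m)) (Ffr.mapIso (SmallFamily.isoOfSmall a))
  onDeltaD n m a := SmallFamily.isoToSmall (obj := stripObj H Dl Ffr Fet Fenv) (i := Sum.inr (Sum.inl n))
    (j := Sum.inr (Sum.inl n)) (Fet.mapIso (autDU htToD H Dl ξ n m (SmallFamily.isoOfSmall a)))
  onR n m a := SmallFamily.isoToSmall (obj := fun n : ℤ => FR.obj (Dl n)) (i := n) (j := n)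
    (FR.mapIso (autDU htToD H Dl ξ n m (SmallFamily.isoOfSmall a)))
  onM n m a := SmallFamily.isoToSmall (obj := fun n : ℤ => FM.obj (Dl n)) (i := n) (j := n)
    (FM.mapIso (autDU htToD H Dl ξ n m (SmallFamily.isoOfSmall a)))

/-- The horizontal arrow of the constructed data is the full poly-isomorphism (as in D and J; [IUTchII] Cor.
4.10 (iv) / [IUTchIII] Thm. 1.5 (ii)). [claim: Mochizuki2012, status: disputed] -/
theorem ofFunctorsSmall_horizontal (n m : ℤ) :
    (ofFunctorsSmall htToD H Dl ξ Ffr Fet kum Fenv nat FR FM).horizontal n m = PolyIso.full _ _ := rfl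

/-- DICTIONARY: the Kummer isomorphism of the constructed data is the TRANSPORT of `kum`'s component at `^{n,m}HT`
followed by `Fet(ξ n m)` — J's `kumAt … ≪≫ Fet.mapIso (ξ n m)`, moved to the small model.
[claim: Mochizuki2012, status: disputed] -/
theorem ofFunctorsSmall_kumDelta (n m : ℤ) :
    (ofFunctorsSmall htToD H Dl ξ Ffr Fet kum Fenv nat FR FM).kumDelta n m =
      SmallFamily.isoToSmall (obj := stripObj H Dl Ffr Fet Fenv) (i := Sum.inl (n, m))
        (j := Sum.inr (Sum.inl n)) (kum.app (H (n, m)) ≪≫ Fet.mapIso (ξ n m)) := rfl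

/-- **(iii) (c), equivariance clause, for the constructed data** = Kummer naturality, transported. [folklore] -/
theorem ofFunctorsSmall_kumDelta_equivariant (n m : ℤ) :
    PolyIsoCalc.Equivariant ((ofFunctorsSmall htToD H Dl ξ Ffr Fet kum Fenv nat FR FM).kumDelta n m)
      {p | ∃ a : (ofFunctorsSmall htToD H Dl ξ Ffr Fet kum Fenv nat FR FM).AutHT n m,
        p = ((ofFunctorsSmall htToD H Dl ξ Ffr Fet kum Fenv nat FR FM).onDelta n m a,
          (ofFunctorsSmall htToD H Dl ξ Ffr Fet kum Fenv nat FR FM).onDeltaD n m a)} := by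
  rintro p ⟨a, rfl⟩
  exact SmallFamily.isoToSmall_sq (kum_equivariant htToD H Dl ξ Ffr Fet kum n m (SmallFamily.isoOfSmall a))

/-- The transported permutation-symmetry poly-isomorphism (functorial image under `G` of the FULL poly-isomorphism
`^{n,∘}HT^D ⥲ ^{n+1,∘}HT^D`) is stabilized by the transported induced automorphisms (J's
`PolyIsoCalc.stabilized_map_full`, moved to the small model). [folklore] -/
theorem stabilized_toSmall_map_full {E : Type u} [Category.{v} E] [LocallySmall.{0} E] (G : DC ⥤ E) (n m : ℤ) :
    PolyIsoCalc.Stabilized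
      (SmallFamily.toSmall (obj := fun n : ℤ => G.obj (Dl n)) (i := n) (j := n + 1)
        ((PolyIso.full (Dl n) (Dl (n + 1))).map G))
      {f | ∃ a : SmallFamily.mk H (n, m) ≅ SmallFamily.mk H (n, m),
        f = SmallFamily.isoToSmall (obj := fun n : ℤ => G.obj (Dl n)) (i := n) (j := n)
          (G.mapIso (autDU htToD H Dl ξ n m (SmallFamily.isoOfSmall a)))}
      {g | ∃ b : SmallFamily.mk H (n + 1, m) ≅ SmallFamily.mk H (n + 1, m),
        g = SmallFamily.isoToSmall (obj := fun n : ℤ => G.obj (Dl n)) (i := n + 1) (j := n + 1)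
          (G.mapIso (autDU htToD H Dl ξ (n + 1) m (SmallFamily.isoOfSmall b)))} := by
  rintro _ ⟨a, rfl⟩ _ ⟨b, rfl⟩ _ ⟨f, hf, rfl⟩
  obtain ⟨ζ, -, rfl⟩ := PolyIso.mem_map.1 hf
  rw [← SmallFamily.isoToSmall_trans, ← SmallFamily.isoToSmall_trans, SmallFamily.isoToSmall_mem_toSmall]
  exact PolyIso.mem_map.2 ⟨autDU htToD H Dl ξ n m (SmallFamily.isoOfSmall a) ≪≫ ζ ≪≫
      autDU htToD H Dl ξ (n + 1) m (SmallFamily.isoOfSmall b), PolyIso.mem_full _,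
    by rw [Functor.mapIso_trans, Functor.mapIso_trans]⟩

/-- **(iii) (c) AS TYPED holds for the constructed data** (equivariance = Kummer naturality; stabilization =
functoriality on the full poly-isomorphism of `D`-`Θ^{±ell}NF`-Hodge theaters) — BOOKKEEPING, as J's
`ofFunctors_partIIIc`, now for frames of any universe. [folklore] -/
theorem ofFunctorsSmall_partIIIc : (ofFunctorsSmall htToD H Dl ξ Ffr Fet kum Fenv nat FR FM).PartIIIc := fun n m =>
  ⟨ofFunctorsSmall_kumDelta_equivariant htToD H Dl ξ Ffr Fet kum Fenv nat FR FM n m,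
    stabilized_toSmall_map_full htToD H Dl ξ FR n m⟩

/-- **(iii) (d) AS TYPED holds for the constructed data** (same mechanism for the `∞κ` data). [folklore] -/
theorem ofFunctorsSmall_partIIId : (ofFunctorsSmall htToD H Dl ξ Ffr Fet kum Fenv nat FR FM).PartIIId := fun n m =>
  stabilized_toSmall_map_full htToD H Dl ξ FM n m

/-- (IPL) for the constructed data: as soon as horizontally adjacent `^{n,m}F⊢×μ_△`, `^{n+1,m}F⊢×μ_△` are isomorphic
in `C` (e.g. the category of `F⊢×μ`-prime-strips is connected — abc-iut-L6-t3's frames), the horizontal full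
poly-isomorphisms of the small model are nonempty. [folklore] -/
theorem ofFunctorsSmall_ipl (h : ∀ n m : ℤ, Nonempty (Ffr.obj (H (n, m)) ≅ Ffr.obj (H (n + 1, m)))) :
    (ofFunctorsSmall htToD H Dl ξ Ffr Fet kum Fenv nat FR FM).IPL := fun n m => by
  obtain ⟨e⟩ := h n m
  exact ⟨SmallFamily.isoToSmall (obj := stripObj H Dl Ffr Fet Fenv) (i := Sum.inl (n, m))
    (j := Sum.inl (n + 1, m)) e, PolyIso.mem_full _⟩

end

/-! ## 3. Over abc-iut-L6-t3's `BiCoricData` on a frame of any universe -/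

section

variable {S : StripFrame.{u}} [LocallySmall.{0} S.HT] [LocallySmall.{0} S.Fxm]
  (B : BiCoricData S) (H : ℤ × ℤ → S.HT) (Dl : ℤ → S.DHT)
  (ξ : ∀ n m : ℤ, S.htToD.obj (H (n, m)) ≅ Dl n) (Fenv : S.DHT ⥤ S.Fxm) (nat : B.dvDelta ⋙ B.fxmOfDv ≅ Fenv)
  {Rad : Type u₄} [Category.{v₄} Rad] [LocallySmall.{0} Rad] (FR : S.DHT ⥤ Rad)
  {Kap : Type u₅} [Category.{v₅} Kap] [LocallySmall.{0} Kap] (FM : S.DHT ⥤ Kap)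

/-- **The objects of (iii) over an L6 `BiCoricData` on a frame `S : StripFrame.{u}` of ANY universe** —
J's `LinkData.ofBiCoric` (Frobenius-like `fxmDeltaHT`, étale-like `dvDelta ⋙ fxmOfDv`, Kummer natural
isomorphism `BiCoricData.kummer`), through the small model. For `u = 0` J's `ofBiCoric` gives the same objects
inside `S.Fxm` itself; for the real frame `StripFrame.ofKits` (`u ≥ 1`) this is the constructor that
typechecks. [claim: Mochizuki2012, status: disputed] -/
def ofBiCoricSmall : LinkData :=
  ofFunctorsSmall S.htToD H Dl ξ B.fxmDeltaHT (B.dvDelta ⋙ B.fxmOfDv) B.kummer Fenv nat FR FM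

/-- DICTIONARY: `F⊢×μ_△(^{n,∘}D⊢_△)` of the constructed data is the index of L6's `B.fxmDeltaOf (^{n,∘}HT^D)` in the
small model, and its Kummer isomorphism is the transport of `B.kummerAt (^{n,m}HT) ≪≫ F⊢×μ_△(D⊢_△(ξ n m))`.
[claim: Mochizuki2012, status: disputed] -/
theorem ofBiCoricSmall_kumDelta (n m : ℤ) :
    (ofBiCoricSmall B H Dl ξ Fenv nat FR FM).kumDelta n m =
      SmallFamily.isoToSmall (obj := stripObj H Dl B.fxmDeltaHT (B.dvDelta ⋙ B.fxmOfDv) Fenv)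
        (i := Sum.inl (n, m)) (j := Sum.inr (Sum.inl n))
        (B.kummerAt (H (n, m)) ≪≫ B.fxmOfDv.mapIso (B.dvDelta.mapIso (ξ n m))) := rfl

/-- (iii) (c) AS TYPED holds over any `BiCoricData`, any universe. [folklore] -/
theorem ofBiCoricSmall_partIIIc : (ofBiCoricSmall B H Dl ξ Fenv nat FR FM).PartIIIc :=
  ofFunctorsSmall_partIIIc _ H Dl ξ _ _ _ Fenv nat FR FM

/-- (iii) (d) AS TYPED holds over any `BiCoricData`, any universe. [folklore] -/
theorem ofBiCoricSmall_partIIId : (ofBiCoricSmall B H Dl ξ Fenv nat FR FM).PartIIId :=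
  ofFunctorsSmall_partIIId _ H Dl ξ _ _ _ Fenv nat FR FM

/-- (IPL) over any `BiCoricData` whose Frobenius-like strips along the lattice are pairwise isomorphic.
[folklore] -/
theorem ofBiCoricSmall_ipl
    (h : ∀ n m : ℤ, Nonempty (B.fxmDeltaHT.obj (H (n, m)) ≅ B.fxmDeltaHT.obj (H (n + 1, m)))) :
    (ofBiCoricSmall B H Dl ξ Fenv nat FR FM).IPL :=
  ofFunctorsSmall_ipl _ H Dl ξ _ _ _ Fenv nat FR FM h

end

end LinkData

/-! ## 4. Theorem 3.11 assembled over the small-model objects -/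

namespace FullSituation

variable {T : ThetaIndex}

variable {S : StripFrame.{u}} [LocallySmall.{0} S.HT] [LocallySmall.{0} S.Fxm]
  (B : BiCoricData S) (H : ℤ × ℤ → S.HT) (Dl : ℤ → S.DHT)
  (ξ : ∀ n m : ℤ, S.htToD.obj (H (n, m)) ≅ Dl n) (Fenv : S.DHT ⥤ S.Fxm) (nat : B.dvDelta ⋙ B.fxmOfDv ≅ Fenv)
  {Rad : Type u₄} [Category.{v₄} Rad] [LocallySmall.{0} Rad] (FR : S.DHT ⥤ Rad)
  {Kap : Type u₅} [Category.{v₅} Kap] [LocallySmall.{0} Kap] (FM : S.DHT ⥤ Kap)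

/-- The full situation whose (i)/(ii)-data are `S₀` and whose (iii)-objects are constructed over a
`BiCoricData` on a frame of any universe. [claim: Mochizuki2012, status: disputed] -/
def ofBiCoricSmall (S₀ : LatticeSituation T) : FullSituation T :=
  { S₀ with link := LinkData.ofBiCoricSmall B H Dl ξ Fenv nat FR FM }

/-- **Theorem 3.11 as typed over these objects is (i) ∧ (ii)** (J's `statement_iff_partI_partII_of_link` with
(iii)(c)/(d) discharged by `ofBiCoricSmall_partIIIc/partIIId`). [folklore] -/
theorem ofBiCoricSmall_statement_iff (S₀ : LatticeSituation T) :
    (ofBiCoricSmall B H Dl ξ Fenv nat FR FM S₀).Statement ↔ S₀.PartI ∧ S₀.PartII :=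
  (ofBiCoricSmall B H Dl ξ Fenv nat FR FM S₀).statement_iff_partI_partII_of_link
    (LinkData.ofBiCoricSmall_partIIIc B H Dl ξ Fenv nat FR FM)
    (LinkData.ofBiCoricSmall_partIIId B H Dl ξ Fenv nat FR FM)

end FullSituation

end Thm311

end IUTFork

end Summit.ABC

end

-- (abc-iut-c312-1 g6, 2026-08-26: comment-only re-land to enqueue the olean build of this module — the
-- 05:33Z accept was stranded by a gate reload window, cf. ops-buildfix «COMMENT-ONLY ENQUEUE RE-LAND»; no content change.)
-- (second enqueue re-land 07:04Z: first re-land p428626 06:28Z produced no olean after 35 min; sibling modules build within the minute.)
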